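import Summits.CriticalPhenomena.PercolationContinuityZ3.Theorems.PercNearOneGluingNoHeavyLowerTailLonelyObserver
import Summits.CriticalPhenomena.PercolationContinuityZ3.Theorems.PercNearOneGluingNearOneGluingExchS1
import HarnessLib

/-!
# `NoHeavyLowerTail` (stmt-CriticalPhenomena-4575) — UT for singleton pockets, part 1: the rows
# (event-form BHK corollaries for vertex sets, the packing events read off the union clusters, the source step)

Lemma factory #6 (`prim-lf-6`, gen 2).  Tools for `Theorems.lonelyObserver_le_bigBlock_upset`
(`…UpwardTransportSingletons.lean`): the Kozma–Nitzan packing chain of `…LevelPacking*.lean` with the observer event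
`{o ↔ S}` replaced by `{o ↔ S} ∩ {C_S ∈ 𝒰}` for an up-set `𝒰` of edge sets (`C_S = ⋃_{s∈S} C_s` the union of the open
edge clusters), which is still an increasing event of `C_S`.

* `negCorr_pred`, `posAssoc_pred`, `negAssoc_pred_compl` — van den Berg–Häggström–Kahn 2006 Thm 1.5 / Thm 1.3 for vertex
  sets `S, T` in EVENT form, for increasing predicates of the union clusters (from the tree's
  `BHK2006_twoSetConditionalAssociation.negCorrelation` / `BHK2006_setClusterConditionalPositiveAssociation`).
* the events of the chain as predicates of union clusters: `joinUp_*` (observer event with the up-set), `bigPred_*`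
  (the guard `{N_c ≥ j+1}`), `otherConn_mono` / `M_eq_Dx_inter` (the separating event `M`), `allConn_eq`,
  `DT_inter_not_pairConn_eq`, `joinUp_set_eq` (target side).
* `sourceStep_upset` — for a singleton source `x`: `μ(E ∩ D_x ∩ Q) · μ(M) ≤ μ(D_x ∩ Q) · μ(E ∩ M)` with
  `E = {o ↔ x} ∩ {C_x ∈ 𝒰}` (KN Lemma 1 with the up-set; BHK Thm 1.5 for the sets `{x}`, `A∖x`, twice).

No definitions, no named facts, no sorries.
-/

noncomputable section

namespace Summit.CriticalPhenomena.PercolationContinuityZ3.Theorems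

open scoped BigOperators Classical Topology
open MeasureTheory Set Filter
open Literature.Probability.LatticeModels (prodBernoulli)
open Literature.Probability.Percolation
open BlockLonelyRelay GuardedBlockLonelyRelay AttachedChampionLevelOne LonelyObserver

variable {n : ℕ}

namespace UTSingletons

/-! ### Event-form corollaries of BHK 2006 for vertex sets (increasing predicates of the union clusters) -/

/-- The set `D = {S ↮ T}` in the form used by the BHK lemmas. [folklore] -/
theorem sepSet_eq (S T : Finset (Fin n)) :
    {ω : BondConfig (Fin n) | ∀ s ∈ (↑S : Set (Fin n)), ∀ t ∈ (↑T : Set (Fin n)), ¬ (openGraph ω).Reachable s t} =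
      {ω | ∀ s ∈ S, ∀ t ∈ T, ω ∉ openConn s t} := by
  ext ω; simp only [mem_setOf_eq, Finset.mem_coe]; rfl

/-- **Negative correlation across `{S ↮ T}`** (BHK 2006 Thm 1.5 for sets): for an increasing predicate `P` of
`C_S` and an increasing predicate `Q` of `C_T`, `μ(D) μ(D ∩ P ∩ Q) ≤ μ(D ∩ P) μ(D ∩ Q)`.
[cite: VandenbergHaggstromKahn2005, Thm. 1.5 (p. 7) with Remark 1 (p. 5); tree `BHK2006_twoSetConditionalAssociation.negCorrelation`] -/
theorem negCorr_pred (w : Sym2 (Fin n) → unitInterval) (S T : Finset (Fin n))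
    (P Q : Set (Sym2 (Fin n)) → Prop)
    (hP : ∀ ⦃C C' : Set (Sym2 (Fin n))⦄, C ⊆ C' → P C → P C')
    (hQ : ∀ ⦃C C' : Set (Sym2 (Fin n))⦄, C ⊆ C' → Q C → Q C') :
    (prodBernoulli w).real {ω | ∀ s ∈ S, ∀ t ∈ T, ω ∉ openConn s t} *
        (prodBernoulli w).real ({ω | ∀ s ∈ S, ∀ t ∈ T, ω ∉ openConn s t} ∩
          ({ω | P (⋃ s ∈ (↑S : Set (Fin n)), openEdgeCluster ω s)} ∩
            {ω | Q (⋃ t ∈ (↑T : Set (Fin n)), openEdgeCluster ω t)})) ≤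
      (prodBernoulli w).real ({ω | ∀ s ∈ S, ∀ t ∈ T, ω ∉ openConn s t} ∩
          {ω | P (⋃ s ∈ (↑S : Set (Fin n)), openEdgeCluster ω s)}) *
        (prodBernoulli w).real ({ω | ∀ s ∈ S, ∀ t ∈ T, ω ∉ openConn s t} ∩
          {ω | Q (⋃ t ∈ (↑T : Set (Fin n)), openEdgeCluster ω t)}) := by
  have key := BHK2006_twoSetConditionalAssociation.negCorrelation w (↑S : Set (Fin n)) (↑T : Set (Fin n))
    (fun C => if P C then (1 : ℝ) else 0) (fun C => if Q C then (1 : ℝ) else 0)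
    (TripodExchange.predIndicator_monotone hP) (TripodExchange.predIndicator_monotone hQ)
  simp only [TwoSetConditionalAssociation.predIndicator_eq_indicator
      (fun ω => P (⋃ s ∈ (↑S : Set (Fin n)), openEdgeCluster ω s)),
    TwoSetConditionalAssociation.predIndicator_eq_indicator
      (fun ω => Q (⋃ t ∈ (↑T : Set (Fin n)), openEdgeCluster ω t)),
    TripodExchange.setIntegral_indicator_one_eq, TripodExchange.setIntegral_indicator_mul_indicator_eq,
    sepSet_eq] at key
  exact key

/-- **Positive association of `C_S` given `{S ↮ T}`** (BHK 2006 Thm 1.3 for sets): for increasing predicates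
`P, Q` of `C_S`, `μ(D ∩ P) μ(D ∩ Q) ≤ μ(D) μ(D ∩ P ∩ Q)`.
[cite: VandenbergHaggstromKahn2005, Thm. 1.3 (p. 6) with Remark 1 (p. 5); tree `BHK2006_setClusterConditionalPositiveAssociation`] -/
theorem posAssoc_pred (w : Sym2 (Fin n) → unitInterval) (S T : Finset (Fin n))
    (P Q : Set (Sym2 (Fin n)) → Prop)
    (hP : ∀ ⦃C C' : Set (Sym2 (Fin n))⦄, C ⊆ C' → P C → P C')
    (hQ : ∀ ⦃C C' : Set (Sym2 (Fin n))⦄, C ⊆ C' → Q C → Q C') :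
    (prodBernoulli w).real ({ω | ∀ s ∈ S, ∀ t ∈ T, ω ∉ openConn s t} ∩
          {ω | P (⋃ s ∈ (↑S : Set (Fin n)), openEdgeCluster ω s)}) *
        (prodBernoulli w).real ({ω | ∀ s ∈ S, ∀ t ∈ T, ω ∉ openConn s t} ∩
          {ω | Q (⋃ s ∈ (↑S : Set (Fin n)), openEdgeCluster ω s)}) ≤
      (prodBernoulli w).real {ω | ∀ s ∈ S, ∀ t ∈ T, ω ∉ openConn s t} *
        (prodBernoulli w).real ({ω | ∀ s ∈ S, ∀ t ∈ T, ω ∉ openConn s t} ∩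
          ({ω | P (⋃ s ∈ (↑S : Set (Fin n)), openEdgeCluster ω s)} ∩
            {ω | Q (⋃ s ∈ (↑S : Set (Fin n)), openEdgeCluster ω s)})) := by
  have key := BHK2006_setClusterConditionalPositiveAssociation w (↑S : Set (Fin n)) (↑T : Set (Fin n))
    (fun C => if P C then (1 : ℝ) else 0) (fun C => if Q C then (1 : ℝ) else 0)
    (TripodExchange.predIndicator_monotone hP) (TripodExchange.predIndicator_monotone hQ)
  simp only [TwoSetConditionalAssociation.predIndicator_eq_indicator
      (fun ω => P (⋃ s ∈ (↑S : Set (Fin n)), openEdgeCluster ω s)),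
    TwoSetConditionalAssociation.predIndicator_eq_indicator
      (fun ω => Q (⋃ s ∈ (↑S : Set (Fin n)), openEdgeCluster ω s)),
    TripodExchange.setIntegral_indicator_one_eq, TripodExchange.setIntegral_indicator_mul_indicator_eq,
    sepSet_eq] at key
  exact key

/-- The decreasing case of the previous lemma: for `P` increasing and `Q` increasing (so `¬Q` decreasing) predicates
of `C_S`, `μ(D) μ(D ∩ P ∩ ¬Q) ≤ μ(D ∩ P) μ(D ∩ ¬Q)`. [cite: VandenbergHaggstromKahn2005, Thm. 1.3 (p. 6, "reversed if one of f, g is decreasing")] -/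
theorem negAssoc_pred_compl (w : Sym2 (Fin n) → unitInterval) (S T : Finset (Fin n))
    (P Q : Set (Sym2 (Fin n)) → Prop)
    (hP : ∀ ⦃C C' : Set (Sym2 (Fin n))⦄, C ⊆ C' → P C → P C')
    (hQ : ∀ ⦃C C' : Set (Sym2 (Fin n))⦄, C ⊆ C' → Q C → Q C') :
    (prodBernoulli w).real {ω | ∀ s ∈ S, ∀ t ∈ T, ω ∉ openConn s t} *
        (prodBernoulli w).real ({ω | ∀ s ∈ S, ∀ t ∈ T, ω ∉ openConn s t} ∩
          ({ω | P (⋃ s ∈ (↑S : Set (Fin n)), openEdgeCluster ω s)} ∩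
            {ω | ¬ Q (⋃ s ∈ (↑S : Set (Fin n)), openEdgeCluster ω s)})) ≤
      (prodBernoulli w).real ({ω | ∀ s ∈ S, ∀ t ∈ T, ω ∉ openConn s t} ∩
          {ω | P (⋃ s ∈ (↑S : Set (Fin n)), openEdgeCluster ω s)}) *
        (prodBernoulli w).real ({ω | ∀ s ∈ S, ∀ t ∈ T, ω ∉ openConn s t} ∩
          {ω | ¬ Q (⋃ s ∈ (↑S : Set (Fin n)), openEdgeCluster ω s)}) := by
  set μ := prodBernoulli w with hμ
  set D : Set (BondConfig (Fin n)) := {ω | ∀ s ∈ S, ∀ t ∈ T, ω ∉ openConn s t} with hD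
  set EP : Set (BondConfig (Fin n)) := {ω | P (⋃ s ∈ (↑S : Set (Fin n)), openEdgeCluster ω s)} with hEP
  set EQ : Set (BondConfig (Fin n)) := {ω | Q (⋃ s ∈ (↑S : Set (Fin n)), openEdgeCluster ω s)} with hEQ
  have hmeas : ∀ s : Set (BondConfig (Fin n)), MeasurableSet s := fun _ => MeasurableSet.of_discrete
  have key : μ.real (D ∩ EP) * μ.real (D ∩ EQ) ≤ μ.real D * μ.real (D ∩ (EP ∩ EQ)) :=
    posAssoc_pred w S T P Q hP hQ
  -- complements inside `D` and `D ∩ EP`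
  have e1 : μ.real (D ∩ {ω | ¬ Q (⋃ s ∈ (↑S : Set (Fin n)), openEdgeCluster ω s)}) =
      μ.real D - μ.real (D ∩ EQ) := by
    have h := measureReal_inter_add_sdiff₀ (μ := μ) (s := D) (t := EQ) (hmeas EQ).nullMeasurableSet
    have hs : D \ EQ = D ∩ {ω | ¬ Q (⋃ s ∈ (↑S : Set (Fin n)), openEdgeCluster ω s)} := by
      ext ω; simp only [hEQ, Set.mem_sdiff, mem_inter_iff, mem_setOf_eq]
    rw [hs] at h; linarith
  have e2 : μ.real (D ∩ (EP ∩ {ω | ¬ Q (⋃ s ∈ (↑S : Set (Fin n)), openEdgeCluster ω s)})) =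
      μ.real (D ∩ EP) - μ.real (D ∩ (EP ∩ EQ)) := by
    have h := measureReal_inter_add_sdiff₀ (μ := μ) (s := D ∩ EP) (t := EQ) (hmeas EQ).nullMeasurableSet
    have hs : (D ∩ EP) \ EQ = D ∩ (EP ∩ {ω | ¬ Q (⋃ s ∈ (↑S : Set (Fin n)), openEdgeCluster ω s)}) := by
      ext ω; simp only [hEQ, Set.mem_sdiff, mem_inter_iff, mem_setOf_eq]; tauto
    have hs' : (D ∩ EP) ∩ EQ = D ∩ (EP ∩ EQ) := by rw [inter_assoc]
    rw [hs, hs'] at h; linarith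
  rw [e1, e2]
  nlinarith [key, measureReal_nonneg (μ := μ) (s := D), measureReal_nonneg (μ := μ) (s := D ∩ EP)]

/-! ### The events of the packing chain, read off the union clusters -/

/-- `⋃_{s ∈ {x}} C_s = C_x`. [folklore] -/
theorem biUnion_singleton_openEdgeCluster (ω : BondConfig (Fin n)) (x : Fin n) :
    (⋃ s ∈ (↑({x} : Finset (Fin n)) : Set (Fin n)), openEdgeCluster ω s) = openEdgeCluster ω x := by
  rw [Finset.coe_singleton, biUnion_singleton]

/-- The observer event with an up-set: `P_B^𝒰(C) := (o ∈ B ∨ ∃ e ∈ C, o ∈ e) ∧ C ∈ 𝒰` is increasing in `C`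
when `𝒰` is an up-set. [folklore] -/
theorem joinUp_mono (B : Set (Fin n)) (o : Fin n) {U : Set (Set (Sym2 (Fin n)))} (hU : IsUpperSet U) :
    ∀ ⦃C C' : Set (Sym2 (Fin n))⦄, C ⊆ C' →
      ((o ∈ B ∨ ∃ e ∈ C, o ∈ e) ∧ C ∈ U) → ((o ∈ B ∨ ∃ e ∈ C', o ∈ e) ∧ C' ∈ U) :=
  fun _ _ hCC' h => ⟨touch_mono B o hCC' h.1, hU hCC' h.2⟩

/-- For the singleton source `{x}`: `{P_{x}^𝒰(C_{{x}})} = {o ↔ x} ∩ {C_x ∈ 𝒰}`. [folklore] -/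
theorem joinUp_singleton_eq (o x : Fin n) (U : Set (Set (Sym2 (Fin n)))) :
    {ω : BondConfig (Fin n) | (o ∈ (↑({x} : Finset (Fin n)) : Set (Fin n)) ∨
        ∃ e ∈ ⋃ s ∈ (↑({x} : Finset (Fin n)) : Set (Fin n)), openEdgeCluster ω s, o ∈ e) ∧
        (⋃ s ∈ (↑({x} : Finset (Fin n)) : Set (Fin n)), openEdgeCluster ω s) ∈ U} =
      (openConn o x : Set (BondConfig (Fin n))) ∩ {ω | openEdgeCluster ω x ∈ U} := by
  ext ω
  have hU : (⋃ s ∈ (↑({x} : Finset (Fin n)) : Set (Fin n)), openEdgeCluster ω s) = openEdgeCluster ω x :=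
    biUnion_singleton_openEdgeCluster ω x
  simp only [mem_setOf_eq, mem_inter_iff]
  rw [hU, Finset.coe_singleton, mem_singleton_iff, ← reachable_iff_exists_mem_openEdgeCluster ω x o]
  exact ⟨fun ⟨h1, h2⟩ => ⟨(h1.symm : (openGraph ω).Reachable o x), h2⟩,
    fun ⟨h1, h2⟩ => ⟨(h1 : (openGraph ω).Reachable o x).symm, h2⟩⟩

/-- The guard `{N_c ≥ j+1}` read off `C_X` for `c ∈ X`: the predicate
`j+1 ≤ |{z ∈ A : c, z joined inside C}|` is increasing, and at `C = C_X(ω)` it is `{j+1 ≤ N_c}`. [folklore] -/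
theorem bigPred_mono (A : Finset (Fin n)) (c : Fin n) (j : ℕ) :
    ∀ ⦃C C' : Set (Sym2 (Fin n))⦄, C ⊆ C' →
      j + 1 ≤ (A.filter fun z => (SimpleGraph.fromEdgeSet C).Reachable c z).card →
      j + 1 ≤ (A.filter fun z => (SimpleGraph.fromEdgeSet C').Reachable c z).card := by
  intro C C' hCC' h
  exact h.trans (Finset.card_le_card (Finset.monotone_filter_right A fun z _ hz =>
    hz.mono (SimpleGraph.fromEdgeSet_mono hCC')))

/-- Evaluation of the guard predicate at `C_X(ω)`, `c ∈ X`. [folklore] -/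
theorem bigPred_eq (A : Finset (Fin n)) (c : Fin n) (j : ℕ) (X : Finset (Fin n)) (hc : c ∈ X) :
    {ω : BondConfig (Fin n) | j + 1 ≤ (A.filter fun z =>
        (SimpleGraph.fromEdgeSet (⋃ s ∈ (↑X : Set (Fin n)), openEdgeCluster ω s)).Reachable c z).card} =
      {ω | j + 1 ≤ (A.filter fun z => ω ∈ openConn c z).card} := by
  ext ω
  simp only [mem_setOf_eq]
  have hfilt : (A.filter fun z =>
      (SimpleGraph.fromEdgeSet (⋃ s ∈ (↑X : Set (Fin n)), openEdgeCluster ω s)).Reachable c z) =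
      A.filter fun z => ω ∈ (openConn c z : Set (BondConfig (Fin n))) := by
    refine Finset.filter_congr fun z _ => ?_
    rw [← reachable_iff_reachable_fromEdgeSet_biUnion ω (↑X : Set (Fin n)) (Finset.mem_coe.2 hc) z]
    rfl
  rw [hfilt]

/-- "Some relay of `T` other than `x` is joined to some third relay" read off `C_{A∖x}`: an increasing predicate. [folklore] -/
theorem otherConn_mono (A T : Finset (Fin n)) (x : Fin n) :
    ∀ ⦃C C' : Set (Sym2 (Fin n))⦄, C ⊆ C' →
      (∃ y ∈ T, ∃ a ∈ A, y ≠ x ∧ a ≠ x ∧ y ≠ a ∧ (SimpleGraph.fromEdgeSet C).Reachable y a) →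
      (∃ y ∈ T, ∃ a ∈ A, y ≠ x ∧ a ≠ x ∧ y ≠ a ∧ (SimpleGraph.fromEdgeSet C').Reachable y a) := by
  rintro C C' hCC' ⟨y, hy, a, ha, h1, h2, h3, hr⟩
  exact ⟨y, hy, a, ha, h1, h2, h3, hr.mono (SimpleGraph.fromEdgeSet_mono hCC')⟩

/-- The separating event `M = {every relay of T is isolated from all other relays}` equals
`D_x ∩ {¬ otherConn(C_{A∖x})}` for `x ∈ T ⊆ A`. [folklore] -/
theorem M_eq_Dx_inter (A T : Finset (Fin n)) (hTA : T ⊆ A) {x : Fin n} (hx : x ∈ T) :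
    {ω : BondConfig (Fin n) | ∀ y ∈ T, ∀ a ∈ A, y ≠ a → ω ∉ openConn y a} =
      {ω | ∀ s ∈ ({x} : Finset (Fin n)), ∀ t ∈ A \ {x}, ω ∉ openConn s t} ∩
        {ω | ¬ (∃ y ∈ T, ∃ a ∈ A, y ≠ x ∧ a ≠ x ∧ y ≠ a ∧
          (SimpleGraph.fromEdgeSet (⋃ s ∈ (↑(A \ {x}) : Set (Fin n)), openEdgeCluster ω s)).Reachable y a)} := by
  ext ω
  simp only [mem_setOf_eq, mem_inter_iff, Finset.mem_singleton, Finset.mem_sdiff, not_exists, not_and]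
  constructor
  · intro hM
    refine ⟨fun s hs t ht => ?_, fun y hy a ha hyx hax hya hr => ?_⟩
    · subst hs
      exact hM s hx t ht.1 (fun h => ht.2 h.symm)
    · have hyS : y ∈ (↑(A \ {x}) : Set (Fin n)) := by
        rw [Finset.coe_sdiff, Finset.coe_singleton]; exact ⟨hTA hy, hyx⟩
      rw [← reachable_iff_reachable_fromEdgeSet_biUnion ω _ hyS a] at hr
      exact hM y hy a ha hya hr
  · rintro ⟨hD, hC⟩ y hy a ha hya hconn
    have hconn' : (openGraph ω).Reachable y a := hconn
    by_cases hyx : y = x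
    · subst hyx
      exact hD y rfl a ⟨ha, fun h => hya h.symm⟩ hconn
    by_cases hax : a = x
    · subst hax
      exact hD a rfl y ⟨hTA hy, hyx⟩ (hconn'.symm)
    · have hyS : y ∈ (↑(A \ {x}) : Set (Fin n)) := by
        rw [Finset.coe_sdiff, Finset.coe_singleton]; exact ⟨hTA hy, hyx⟩
      exact hC y hy a ha hyx hax hya ((reachable_iff_reachable_fromEdgeSet_biUnion ω _ hyS a).1 hconn')

/-! ### Source step (singleton source `x`, guard `{N_c ≥ j+1}`, observer event with the up-set) -/

/-- **Source step with an up-set.**  For `x ∈ T ⊆ A`, `c ∈ A`, `c ≠ x`, an up-set `𝒰`,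
`E = {o ↔ x} ∩ {C_x ∈ 𝒰}`, `D_x = {x ↮ A∖x}`, `Q = {N_c ≥ j+1}`, `M = {T's relays isolated from all other relays}`:
`μ(E ∩ D_x ∩ Q) · μ(M) ≤ μ(D_x ∩ Q) · μ(E ∩ M)`.  Two applications of BHK Thm 1.5 for the sets `{x}`, `A∖x`:
the guard and "another source meets another relay" are increasing events of `C_{A∖x}`, `E` is an increasing event
of `C_x`. [cite: KozmaNitzan2024, Lemma 1 (p. 5); VandenbergHaggstromKahn2005, Thm. 1.5 (p. 7)] -/
theorem sourceStep_upset (w : Sym2 (Fin n) → unitInterval) (A T : Finset (Fin n)) (hTA : T ⊆ A)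
    (o c : Fin n) (j : ℕ) (hc : c ∈ A) {x : Fin n} (hx : x ∈ T) (hxc : x ≠ c)
    (U : Set (Set (Sym2 (Fin n)))) (hU : IsUpperSet U) :
    (prodBernoulli w).real ((openConn o x : Set (BondConfig (Fin n))) ∩ {ω | openEdgeCluster ω x ∈ U} ∩
        {ω | ∀ s ∈ ({x} : Finset (Fin n)), ∀ t ∈ A \ {x}, ω ∉ openConn s t} ∩
        {ω | j + 1 ≤ (A.filter fun z => ω ∈ openConn c z).card}) *
      (prodBernoulli w).real {ω : BondConfig (Fin n) | ∀ y ∈ T, ∀ a ∈ A, y ≠ a → ω ∉ openConn y a} ≤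
    (prodBernoulli w).real ({ω | ∀ s ∈ ({x} : Finset (Fin n)), ∀ t ∈ A \ {x}, ω ∉ openConn s t} ∩
        {ω | j + 1 ≤ (A.filter fun z => ω ∈ openConn c z).card}) *
      (prodBernoulli w).real ((openConn o x : Set (BondConfig (Fin n))) ∩ {ω | openEdgeCluster ω x ∈ U} ∩
        {ω : BondConfig (Fin n) | ∀ y ∈ T, ∀ a ∈ A, y ≠ a → ω ∉ openConn y a}) := by
  set μ := prodBernoulli w with hμ
  have hmeas : ∀ s : Set (BondConfig (Fin n)), MeasurableSet s := fun _ => MeasurableSet.of_discrete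
  -- the three predicates
  set P : Set (Sym2 (Fin n)) → Prop := fun C =>
    (o ∈ (↑({x} : Finset (Fin n)) : Set (Fin n)) ∨ ∃ e ∈ C, o ∈ e) ∧ C ∈ U with hP
  set Qp : Set (Sym2 (Fin n)) → Prop := fun C =>
    j + 1 ≤ (A.filter fun z => (SimpleGraph.fromEdgeSet C).Reachable c z).card with hQp
  set Cn : Set (Sym2 (Fin n)) → Prop := fun C =>
    ∃ y ∈ T, ∃ a ∈ A, y ≠ x ∧ a ≠ x ∧ y ≠ a ∧ (SimpleGraph.fromEdgeSet C).Reachable y a with hCn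
  have hPm : ∀ ⦃C C' : Set (Sym2 (Fin n))⦄, C ⊆ C' → P C → P C' := joinUp_mono _ o hU
  have hQm : ∀ ⦃C C' : Set (Sym2 (Fin n))⦄, C ⊆ C' → Qp C → Qp C' := bigPred_mono A c j
  have hCm : ∀ ⦃C C' : Set (Sym2 (Fin n))⦄, C ⊆ C' → Cn C → Cn C' := otherConn_mono A T x
  -- events
  set D : Set (BondConfig (Fin n)) := {ω | ∀ s ∈ ({x} : Finset (Fin n)), ∀ t ∈ A \ {x}, ω ∉ openConn s t} with hD
  set EP : Set (BondConfig (Fin n)) :=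
    {ω | P (⋃ s ∈ (↑({x} : Finset (Fin n)) : Set (Fin n)), openEdgeCluster ω s)} with hEP
  set EQ : Set (BondConfig (Fin n)) :=
    {ω | Qp (⋃ t ∈ (↑(A \ {x}) : Set (Fin n)), openEdgeCluster ω t)} with hEQ
  set EC : Set (BondConfig (Fin n)) :=
    {ω | Cn (⋃ t ∈ (↑(A \ {x}) : Set (Fin n)), openEdgeCluster ω t)} with hEC
  set M : Set (BondConfig (Fin n)) := {ω | ∀ y ∈ T, ∀ a ∈ A, y ≠ a → ω ∉ openConn y a} with hM
  -- identifications
  have hEP_eq : EP = (openConn o x : Set (BondConfig (Fin n))) ∩ {ω | openEdgeCluster ω x ∈ U} :=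
    joinUp_singleton_eq o x U
  have hcX : c ∈ A \ {x} := Finset.mem_sdiff.2 ⟨hc, fun h => hxc (Finset.mem_singleton.1 h).symm⟩
  have hEQ_eq : EQ = {ω | j + 1 ≤ (A.filter fun z => ω ∈ openConn c z).card} := bigPred_eq A c j (A \ {x}) hcX
  have hM_eq : M = D ∩ {ω | ¬ Cn (⋃ t ∈ (↑(A \ {x}) : Set (Fin n)), openEdgeCluster ω t)} :=
    M_eq_Dx_inter A T hTA hx
  -- BHK twice
  have hneg : μ.real D * μ.real (D ∩ (EP ∩ EQ)) ≤ μ.real (D ∩ EP) * μ.real (D ∩ EQ) :=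
    negCorr_pred w {x} (A \ {x}) P Qp hPm hQm
  have hsep0 : μ.real D * μ.real (D ∩ (EP ∩ EC)) ≤ μ.real (D ∩ EP) * μ.real (D ∩ EC) :=
    negCorr_pred w {x} (A \ {x}) P Cn hPm hCm
  -- complement form of `hsep0`: `μ(D) μ(D ∩ EP ∩ ECᶜ) ≥ μ(D ∩ EP) μ(D ∩ ECᶜ)`
  have e1 : μ.real (D ∩ ECᶜ) = μ.real D - μ.real (D ∩ EC) := by
    have h : μ.real (D ∩ EC) + μ.real (D ∩ ECᶜ) = μ.real D :=
      measureReal_inter_add_sdiff₀ (μ := μ) (s := D) (t := EC) (hmeas EC).nullMeasurableSet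
    linarith
  have e2 : μ.real (D ∩ EP ∩ ECᶜ) = μ.real (D ∩ EP) - μ.real (D ∩ (EP ∩ EC)) := by
    have h : μ.real (D ∩ EP ∩ EC) + μ.real (D ∩ EP ∩ ECᶜ) = μ.real (D ∩ EP) :=
      measureReal_inter_add_sdiff₀ (μ := μ) (s := D ∩ EP) (t := EC) (hmeas EC).nullMeasurableSet
    rw [inter_assoc D EP EC] at h; linarith
  have hsep : μ.real (D ∩ EP) * μ.real (D ∩ ECᶜ) ≤ μ.real D * μ.real (D ∩ EP ∩ ECᶜ) := by
    rw [e1, e2]; nlinarith [hsep0]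
  -- `M = D ∩ ECᶜ`, `E ∩ M = D ∩ EP ∩ ECᶜ`
  have hM' : M = D ∩ ECᶜ := by rw [hM_eq]; rfl
  have hEM : (openConn o x : Set (BondConfig (Fin n))) ∩ {ω | openEdgeCluster ω x ∈ U} ∩ M =
      D ∩ EP ∩ ECᶜ := by
    rw [← hEP_eq, hM']; ext ω; simp only [mem_inter_iff]; tauto
  have hsrc : (openConn o x : Set (BondConfig (Fin n))) ∩ {ω | openEdgeCluster ω x ∈ U} ∩ D ∩
      {ω | j + 1 ≤ (A.filter fun z => ω ∈ openConn c z).card} = D ∩ (EP ∩ EQ) := by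
    rw [← hEP_eq, ← hEQ_eq]; ext ω; simp only [mem_inter_iff]; tauto
  have hDQ : D ∩ {ω | j + 1 ≤ (A.filter fun z => ω ∈ openConn c z).card} = D ∩ EQ := by rw [← hEQ_eq]
  rw [hsrc, hDQ, hEM, hM']
  -- arithmetic: d g ≤ e q and e m ≤ d f ⟹ g m ≤ q f
  set d := μ.real D
  set g := μ.real (D ∩ (EP ∩ EQ))
  set e := μ.real (D ∩ EP)
  set q := μ.real (D ∩ EQ)
  set m := μ.real (D ∩ ECᶜ)
  set f := μ.real (D ∩ EP ∩ ECᶜ)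
  have hg0 : 0 ≤ g := measureReal_nonneg
  have hq0 : 0 ≤ q := measureReal_nonneg
  have hm0 : 0 ≤ m := measureReal_nonneg
  have hf0 : 0 ≤ f := measureReal_nonneg
  have hgd : g ≤ d := measureReal_mono (fun ω hω => hω.1) (measure_ne_top _ _)
  rcases (measureReal_nonneg : 0 ≤ d).eq_or_lt with hd0 | hdpos
  · have hg' : g = 0 := le_antisymm (hd0 ▸ hgd) hg0
    rw [hg', zero_mul]; exact mul_nonneg hq0 hf0
  · have h1 : d * (g * m) ≤ d * (q * f) := by
      calc d * (g * m) = (d * g) * m := by ring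
        _ ≤ (e * q) * m := mul_le_mul_of_nonneg_right hneg hm0
        _ = q * (e * m) := by ring
        _ ≤ q * (d * f) := mul_le_mul_of_nonneg_left hsep hq0
        _ = d * (q * f) := by ring
    exact le_of_mul_le_mul_left h1 hdpos

/-! ### Target step and the packing of the singleton sources into a joined target block -/

/-- `{J(C_T)} = J_T = {T pairwise joined}`. [folklore] -/
theorem allConn_eq (T : Finset (Fin n)) :
    {ω : BondConfig (Fin n) | ∀ t ∈ T, ∀ t' ∈ T,
        (SimpleGraph.fromEdgeSet (⋃ s ∈ (↑T : Set (Fin n)), openEdgeCluster ω s)).Reachable t t'} =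
      {ω | ∀ t ∈ T, ∀ t' ∈ T, ω ∈ openConn t t'} := by
  ext ω
  simp only [mem_setOf_eq]
  refine forall₂_congr fun t ht => forall₂_congr fun t' _ => ?_
  rw [← reachable_iff_reachable_fromEdgeSet_biUnion ω (↑T : Set (Fin n)) (Finset.mem_coe.2 ht) t']
  rfl

/-- `D_T ∩ {¬ pairConn(C_T)} = M`. [folklore] -/
theorem DT_inter_not_pairConn_eq (A T : Finset (Fin n)) :
    {ω : BondConfig (Fin n) | ∀ s ∈ T, ∀ t ∈ A \ T, ω ∉ openConn s t} ∩
        {ω | ¬ (∃ s ∈ (↑T : Set (Fin n)), ∃ s' ∈ (↑T : Set (Fin n)), s ≠ s' ∧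
          (SimpleGraph.fromEdgeSet (⋃ x ∈ (↑T : Set (Fin n)), openEdgeCluster ω x)).Reachable s s')} =
      {ω | ∀ s ∈ T, ∀ t ∈ A \ T, ω ∉ openConn s t} ∩ {ω | ∀ t ∈ T, ∀ t' ∈ T, t ≠ t' → ω ∉ openConn t t'} := by
  ext ω
  constructor
  · rintro ⟨hD, hnc⟩
    refine ⟨hD, fun t ht t' ht' hne hconn => hnc ⟨t, Finset.mem_coe.2 ht, t', Finset.mem_coe.2 ht', hne, ?_⟩⟩
    exact (reachable_iff_reachable_fromEdgeSet_biUnion ω (↑T : Set (Fin n)) (Finset.mem_coe.2 ht) t').1 hconn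
  · rintro ⟨hD, hsep⟩
    refine ⟨hD, ?_⟩
    rintro ⟨t, ht, t', ht', hne, hr⟩
    exact hsep t (Finset.mem_coe.1 ht) t' (Finset.mem_coe.1 ht') hne
      ((reachable_iff_reachable_fromEdgeSet_biUnion ω (↑T : Set (Fin n)) ht t').2 hr)

/-- The target observer event read off `C_T`: `{P_T^𝒰(C_T)} = {o ↔ T} ∩ {C_T ∈ 𝒰}`. [folklore] -/
theorem joinUp_set_eq (T : Finset (Fin n)) (o : Fin n) (U : Set (Set (Sym2 (Fin n)))) :
    {ω : BondConfig (Fin n) | (o ∈ (↑T : Set (Fin n)) ∨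
        ∃ e ∈ ⋃ s ∈ (↑T : Set (Fin n)), openEdgeCluster ω s, o ∈ e) ∧
        (⋃ s ∈ (↑T : Set (Fin n)), openEdgeCluster ω s) ∈ U} =
      {ω | ∃ t ∈ T, ω ∈ openConn o t} ∩ {ω | (⋃ s ∈ (↑T : Set (Fin n)), openEdgeCluster ω s) ∈ U} := by
  ext ω
  simp only [mem_setOf_eq, mem_inter_iff]
  refine and_congr_left fun _ => ?_
  simp only [mem_iUnion, exists_prop, Finset.mem_coe]
  constructor
  · rintro (ho | ⟨e, ⟨s, hs, he⟩, hoe⟩)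
    · exact ⟨o, ho, (SimpleGraph.Reachable.refl o : (openGraph ω).Reachable o o)⟩
    · exact ⟨s, hs, (((mem_openEdgeCluster_iff ω s e).1 he).2.2 o hoe).symm⟩
  · rintro ⟨b, hb, hob⟩
    rcases (reachable_iff_exists_mem_openEdgeCluster ω b o).1
        (SimpleGraph.Reachable.symm (hob : (openGraph ω).Reachable o b)) with hob' | ⟨e, he, hoe⟩
    · exact Or.inl (hob' ▸ hb)
    · exact Or.inr ⟨e, ⟨b, hb, he⟩, hoe⟩


end UTSingletons

end Summit.CriticalPhenomena.PercolationContinuityZ3.Theorems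

end
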